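import Summits.QuantumFields.BalabanUV.T4Continuum.Support.VectorLineTransport
import Summits.QuantumFields.BalabanUV.T4Continuum.Support.VariationalVectorForm
import Summits.QuantumFields.BalabanUV.T4Continuum.Support.VariationalColourFederbush

/-!
# T⁴ programme, spine node NE2 (U1a), lane P2 — SUPPLIER LEAF V-FED: THE COVARIANT FEDERBUSH INEQUALITY FOR THE CURL FORM OF
# `E`-VALUED 1-FORMS under the LINE-indexed transported average `QvL` (⊇ `QvT`), ADDITIVE FORM, one block step, every torus
# (lattice units; `t4/skeletons/NE2-t4-ne2-p2.md` v0.14 §2.E row V-FED; cell `pub-balaban`)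

NE2 formalisation swarm `b2b-balaban-t4-ne2-formalise-*`, leaf prover 01 GEN 5 (`prover-b2b-balaban-t4-ne2-formalise-leaf-01-g5-0`); journal
INTENT CLAIMS.log 2026-08-20 11:03Z.  On top of leaf-03-g4's `VectorLineTransport` (`QvL`, the line-sum average with LINE-indexed transports —
the road owner's carrier of the tower, RULING l.11674), the owner's `VariationalVectorForm` (`cdV`∕`curlV`∕`curlSq`, decision (D2)) and the colour
Federbush file `VariationalColourFederbush` (`piTv`, `norm_piTv_le_one`: straight transporters) — all BY NAME.

THE STATEMENT (row V-FED «covariant Federbush for the CURL form, additive»; model level).  One block step of side `n` from the fine torus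
`Tor (fine n M)` to `Tor M`; `E` any normed ℂ-space; fine 1-form `W : Tor (fine n M) → Fin d → E`.  DATA: coarse bond transports
`Rc(y,μ) : E →L[ℂ] E`, fine bond transports `R′(x,μ)` (`‖R′‖ ≤ 1`), line transports `T(y,j,t,μ)` (`‖T‖ ≤ 1`; start block, start digit, position,
direction — [Balaban1985AveragingOperations] (125) SHAPE) of the average `(Q_T W)(y,μ) = n^{−(d+1)} Σ_j Σ_t T(y,j,t,μ)(W(n·y + j + t e_μ, μ))`, and
TWO mismatch bounds, both operator norms, both `= 0` at flat background:
 (M1) ACROSS BLOCKS, one per line point `p = n·y + j + t e_ν` and transverse direction `μ`: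
      `‖Rc(y,μ) ∘ T(y+e_μ, j, t, ν) − T(y, j, t, ν) ∘ Π^μ_n(p)‖ ≤ m`            (`misL`; FED⁺'s `misv` shape on line points)
 (M2) INSIDE THE BLOCK, the two comb paths from `x = n·y + j + s e_μ + t e_ν` to the block frame:
      `‖T(y,j,t,ν) ∘ Π^μ_s(n·y + j + t e_ν) − T(y,j,s,μ) ∘ Π^ν_t(n·y + j + s e_μ)‖ ≤ w′`   (`pathL`; for contour transports `≲ s·t·a′`)
(`Π^μ_s(p) = R′(p,μ)∘⋯∘R′(p+(s−1)e_μ,μ)` the straight transporter `piTv`).  THEN, for every plane `(μ, ν)`,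
  `Σ_y ‖curl_{Rc}(Q_T W)(y,μ,ν)‖² ≤ ( √(n²·C′_{μν}∕n^d) + (2m + 2n·w′)·√(Y∕n^d) )²`,  `C′_{μν} = Σ_x‖curl_{R′}W(x,μ,ν)‖²`, `Y = Σ_{x,μ}‖W(x,μ)‖²`
(companion file `VariationalVectorFederbushSum`: `sum_sq_curlV_QvL_le`, and summed over ordered planes `curlSq_QvL_le`:
`curlSq Rc (Q_T W) ≤ (√(n²·curlSq R′ W∕n^d) + d(2m + 2nw′)·√(Y∕n^d))²`).  THIS FILE: the EXACT DECOMPOSITION and the POINTWISE BOUND behind it.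
MAIN TERM CONSTANT EXACTLY 1 — at `m = w′ = 0` this is the tree's U = 1 theorem `B5AverageCurlStokes.sum_normSq_plaq_QvOp_le`
(`n^d Σ_y|plaq(Q_kA)|² ≤ n² Σ_x|plaq A|²`, [Federbush1986PhaseCellI] (0.12) «averaging decreases the action»); the background enters ONLY through
`(m, w′)`, linearly inside the square.  The physical-units reading in the owner's letters (`ScV`∕`SfV`∕`qVV`, the `hFED` binder of
`VariationalVectorForm.vector_pair_bracket_sqrt`) is the companion file `VariationalVectorFederbushPhys`.
 * §1 carriers `misL`, `pathL`, `norm_pathL_le_one`; §2 `line_telescope` (covariant telescoping of a 1-form component along a straight fine path),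
   `line_decomp` (one line of the average through one coarse bond: FED⁺'s decomposition), `cdV_QvL_eq`, **`curlV_QvL_eq`** — THE EXACT DECOMPOSITION
   (covariant abelian Stokes on the `n × n` square with comb transports): `curl(Q_T W) = n^{−(d+1)}•Σ_j[Σ_{t,s}(A_{jst}(curl′W(x_{jst})) + (A_{jst} −
   B_{jst})(D_νW_μ(x_{jst}))) + Σ_t Mis(W) − Σ_s Mis(W)]`; §3 **`norm_curlV_QvL_le`** (the pointwise bound).  The counting (Cauchy–Schwarz, block bijection,
   Minkowski) and the two summed theorems are in `VariationalVectorFederbushSum`.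
WHAT IS NOT HERE: the gauge∕curvature functional `G` of (D2) (leaf V-GF), the sizes of `(m, w′)` for contour transports of a background with
plaquette defect `a′` (the taxi∕CLASS lineage), V-ONE∕V-P∕V-REG, any identification of the transports with Bałaban's `R(U(Γ))` (DATA; c5).

HONEST FRAMING (T4-DAG p. 1).  Model level; [folklore] telescoping + Cauchy–Schwarz + block bijection; nothing printed is a hypothesis; data `def`s
`misL`, `pathL` only, no `def … : Prop`, no `sorry`; axioms standard.  NE2 NOT proved; spine PROVED 0∕9 unchanged; rung (B)+1 finite T⁴ — NOT
infinite volume, NOT mass gap, NOT Clay.  HONEST DEPENDENCY (cell, verbatim): continuum YM on T⁴ ⇐ BetaPertH ∧ nine spine estimates (0/9 proved);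
BetaPertH ⇐ (D1) ∧ (D4) ∧ CAP+tail; G-an2-4 gates asym, D1 and NE2/3/4.
-/

noncomputable section

namespace Summit.QuantumFields.BalabanUV.T4Continuum.VariationalVectorFederbush

open Finset
open Literature.MathematicalPhysics.QuantumFieldTheory.Balaban1983to89
open Literature.MathematicalPhysics.QuantumFieldTheory.Balaban1983to89.B5Prop11Plancherel (Tor fine unitVec)
open Literature.MathematicalPhysics.QuantumFieldTheory.Balaban1983to89.B5Block118 (tstep tstep_zero tstep_succ bpt bpt_add_tstep)
open Summit.QuantumFields.BalabanUV.T4Continuum.VariationalCovariantFederbush (sq_sum_le_card_mul sum_blocks_translate sum_sq_add_le sum_fin_sq_add_le)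
open Summit.QuantumFields.BalabanUV.T4Continuum.VariationalColourFederbush (piTv norm_piTv_le_one)
open Summit.QuantumFields.BalabanUV.T4Continuum.VectorBlockTrialForm (nsqV nsqV_nonneg QvL)
open Summit.QuantumFields.BalabanUV.T4Continuum.VariationalVectorForm (cdV curlV curlSq curlSq_nonneg)

variable {d : ℕ} {E : Type*} [NormedAddCommGroup E] [NormedSpace ℂ E]
variable (n : ℕ) [NeZero n] (M : Fin d → ℕ) [hM : ∀ μ, NeZero (M μ)]

/-! ## §1 Carriers: the across-block line mismatch and the in-block comb transport -/

/-- **the ACROSS-BLOCK LINE MISMATCH** of the line point `p = n·y + j + t e_ν` (position `t` of the `ν`-line started at `n·y + j`) in the transverse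
direction `μ`: `Mis(y,j,t;μ,ν) = Rc(y,μ) ∘ T(y+e_μ, j, t, ν) − T(y, j, t, ν) ∘ Π^μ_n(p)` — the coarse transporter followed by the neighbouring block's
line transport, against this block's line transport after the straight fine transporter of `n` bonds (FED⁺'s `misv` shape, one per line point;
`= 0` at flat background). [folklore] -/
def misL (Rc : Tor M → Fin d → (E →L[ℂ] E)) (R' : Tor (fine n M) → Fin d → (E →L[ℂ] E))
    (T : Tor M → (Fin d → Fin n) → Fin n → Fin d → (E →L[ℂ] E)) (y : Tor M) (j : Fin d → Fin n) (t : Fin n) (μ ν : Fin d) : E →L[ℂ] E :=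
  Rc y μ * T (y + unitVec M μ) j t ν - T y j t ν * piTv n M R' (bpt n M y j + tstep (fine n M) ν t) μ n

/-- **the IN-BLOCK COMB TRANSPORT** from the fine point `x = n·y + j + t e_ν + s e_μ` to the block frame: `A(y,j,s,t;μ,ν) = T(y,j,t,ν) ∘ Π^μ_s(n·y + j + t e_ν)`
(`s` bonds back along `μ` to the `ν`-line, then that line's transport at position `t`).  The other comb is `A(y,j,t,s;ν,μ)`; hypothesis (M2) bounds
their difference (`= 0` at flat background; the holonomy defect of the `s × t` rectangle for contour transports). [folklore] -/
def pathL (R' : Tor (fine n M) → Fin d → (E →L[ℂ] E)) (T : Tor M → (Fin d → Fin n) → Fin n → Fin d → (E →L[ℂ] E))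
    (y : Tor M) (j : Fin d → Fin n) (s t : Fin n) (μ ν : Fin d) : E →L[ℂ] E :=
  T y j t ν * piTv n M R' (bpt n M y j + tstep (fine n M) ν t) μ s

omit [NeZero n] hM in
/-- contractive data give contractive comb transports: `‖A‖ ≤ 1`. [folklore] -/
theorem norm_pathL_le_one {R' : Tor (fine n M) → Fin d → (E →L[ℂ] E)} (hR' : ∀ x μ, ‖R' x μ‖ ≤ 1)
    {T : Tor M → (Fin d → Fin n) → Fin n → Fin d → (E →L[ℂ] E)} (hT : ∀ y j t μ, ‖T y j t μ‖ ≤ 1)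
    (y : Tor M) (j : Fin d → Fin n) (s t : Fin n) (μ ν : Fin d) : ‖pathL n M R' T y j s t μ ν‖ ≤ 1 := by
  unfold pathL
  calc _ ≤ ‖T y j t ν‖ * ‖piTv n M R' (bpt n M y j + tstep (fine n M) ν t) μ s‖ := norm_mul_le _ _
    _ ≤ 1 * 1 := mul_le_mul (hT _ _ _ _) (norm_piTv_le_one n M hR' _ _ _) (norm_nonneg _) zero_le_one
    _ = 1 := one_mul 1

/-! ## §2 Covariant telescoping along a line, one line through one coarse bond, and THE EXACT DECOMPOSITION of the coarse curl -/

section Decomposition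

variable (Rc : Tor M → Fin d → (E →L[ℂ] E)) (R' : Tor (fine n M) → Fin d → (E →L[ℂ] E))
  (T : Tor M → (Fin d → Fin n) → Fin n → Fin d → (E →L[ℂ] E))

omit [NeZero n] hM in
/-- covariant telescoping of the `ν`-component along `t` fine bonds in direction `μ`:
`Π^μ_t(p)(W(p + t e_μ, ν)) − W(p, ν) = Σ_{s<t} Π^μ_s(p)((D_μW_ν)(p + s e_μ))` (linearity of the transporters only). [folklore] -/
theorem line_telescope (W : Tor (fine n M) → Fin d → E) (p : Tor (fine n M)) (μ ν : Fin d) (t : ℕ) :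
    piTv n M R' p μ t (W (p + tstep (fine n M) μ t) ν) - W p ν
      = ∑ s ∈ range t, piTv n M R' p μ s (cdV (fine n M) R' W (p + tstep (fine n M) μ s) μ ν) := by
  induction t with
  | zero => simp [piTv, tstep_zero]
  | succ t ih =>
    rw [sum_range_succ, ← ih]
    simp only [piTv, cdV, mul_apply_eq_comp, map_sub, tstep_succ, ← add_assoc]
    abel

omit [NeZero n] hM in
/-- **ONE LINE THROUGH ONE COARSE BOND** (FED⁺'s decomposition for the line point `p = n·y + j + t e_ν`):
`Rc(y,μ)(T(y+e_μ,j,t,ν)(W(p + n e_μ, ν))) − T(y,j,t,ν)(W(p, ν)) = T(y,j,t,ν)(Σ_{s<n} Π^μ_s(p)((D_μW_ν)(p + s e_μ))) + Mis(y,j,t;μ,ν)(W(p + n e_μ, ν))`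
(uses `B(y) + n e_μ = B(y + e_μ)`, tree `B5Block118.bpt_add_tstep`; no commutativity). [folklore] -/
theorem line_decomp (W : Tor (fine n M) → Fin d → E) (y : Tor M) (j : Fin d → Fin n) (t : Fin n) (μ ν : Fin d) :
    Rc y μ (T (y + unitVec M μ) j t ν (W (bpt n M (y + unitVec M μ) j + tstep (fine n M) ν t) ν))
        - T y j t ν (W (bpt n M y j + tstep (fine n M) ν t) ν)
      = T y j t ν (∑ s ∈ range n, piTv n M R' (bpt n M y j + tstep (fine n M) ν t) μ s
            (cdV (fine n M) R' W (bpt n M y j + tstep (fine n M) ν t + tstep (fine n M) μ s) μ ν))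
        + misL n M Rc R' T y j t μ ν (W (bpt n M y j + tstep (fine n M) ν t + tstep (fine n M) μ n) ν) := by
  have hp : bpt n M (y + unitVec M μ) j + tstep (fine n M) ν t = bpt n M y j + tstep (fine n M) ν t + tstep (fine n M) μ n := by
    rw [← bpt_add_tstep, add_right_comm]
  rw [hp, ← line_telescope, map_sub]
  simp only [misL, sub_apply, mul_apply_eq_comp]
  abel

omit [NeZero n] hM in
/-- one covariant difference of the average, line by line: `(D_μ(Q_T W)_ν)(y) = n^{−(d+1)} • Σ_j Σ_t [Rc(y,μ)(T(y+e_μ,j,t,ν)(W(…))) − T(y,j,t,ν)(W(…))]`.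
[folklore] -/
theorem cdV_QvL_eq (W : Tor (fine n M) → Fin d → E) (y : Tor M) (μ ν : Fin d) :
    cdV M Rc (QvL n M T W) y μ ν
      = (((n : ℂ) ^ (d + 1))⁻¹ : ℂ) • ∑ j : Fin d → Fin n, ∑ t : Fin n,
          (Rc y μ (T (y + unitVec M μ) j t ν (W (bpt n M (y + unitVec M μ) j + tstep (fine n M) ν t) ν))
            - T y j t ν (W (bpt n M y j + tstep (fine n M) ν t) ν)) := by
  unfold cdV QvL
  rw [map_smul, map_sum, ← smul_sub, ← sum_sub_distrib]
  congr 1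
  refine sum_congr rfl fun j _ => ?_
  rw [map_sum, ← sum_sub_distrib]

omit [NeZero n] hM in
/-- **THE EXACT DECOMPOSITION OF THE COARSE CURL** (covariant abelian Stokes on the `n × n` square with comb transports; `x_{jst} = n·y + j + t e_ν + s e_μ`):
`curl_{Rc}(Q_T W)(y,μ,ν) = n^{−(d+1)} • Σ_j [ Σ_t Σ_s ( A_{jst}(curl_{R′}W(x_{jst},μ,ν)) + (A_{jst} − B_{jst})((D_νW_μ)(x_{jst})) )
  + Σ_t Mis(y,j,t;μ,ν)(W(n·y+j+te_ν+ne_μ, ν)) − Σ_s Mis(y,j,s;ν,μ)(W(n·y+j+se_μ+ne_ν, μ)) ]`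
with `A_{jst} = pathL y j s t μ ν`, `B_{jst} = pathL y j t s ν μ` — at flat background `A = B = 1`, `Mis = 0` and this is §3 `plaq_QvOp` of
`B5AverageCurlStokes` («plaquette of the average = average of the squares»). [folklore] -/
theorem curlV_QvL_eq (W : Tor (fine n M) → Fin d → E) (y : Tor M) (μ ν : Fin d) :
    curlV M Rc (QvL n M T W) y μ ν
      = (((n : ℂ) ^ (d + 1))⁻¹ : ℂ) • ∑ j : Fin d → Fin n,
          ( ∑ t : Fin n, ∑ s : Fin n,
              ( pathL n M R' T y j s t μ ν (curlV (fine n M) R' W (bpt n M y j + tstep (fine n M) ν t + tstep (fine n M) μ s) μ ν)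
                + (pathL n M R' T y j s t μ ν - pathL n M R' T y j t s ν μ)
                    (cdV (fine n M) R' W (bpt n M y j + tstep (fine n M) ν t + tstep (fine n M) μ s) ν μ) )
            + ∑ t : Fin n, misL n M Rc R' T y j t μ ν (W (bpt n M y j + tstep (fine n M) ν t + tstep (fine n M) μ n) ν)
            - ∑ s : Fin n, misL n M Rc R' T y j s ν μ (W (bpt n M y j + tstep (fine n M) μ s + tstep (fine n M) ν n) μ) ) := by
  unfold curlV
  rw [cdV_QvL_eq, cdV_QvL_eq, ← smul_sub, ← sum_sub_distrib]
  congr 1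
  refine sum_congr rfl fun j _ => ?_
  simp_rw [line_decomp n M Rc R' T]
  rw [sum_add_distrib, sum_add_distrib, add_sub_add_comm, add_sub_assoc]
  congr 1
  -- the two main terms: range → Fin, `T(Σ Π v) = Σ (T∘Π) v`, swap `s ↔ t` in the second, and split `A·D_μW_ν − B·D_νW_μ`
  have hA : ∀ t : Fin n, T y j t ν (∑ s ∈ range n, piTv n M R' (bpt n M y j + tstep (fine n M) ν t) μ s
        (cdV (fine n M) R' W (bpt n M y j + tstep (fine n M) ν t + tstep (fine n M) μ s) μ ν))
      = ∑ s : Fin n, pathL n M R' T y j s t μ ν (cdV (fine n M) R' W (bpt n M y j + tstep (fine n M) ν t + tstep (fine n M) μ s) μ ν) := by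
    intro t
    rw [map_sum, ← Fin.sum_univ_eq_sum_range]
    rfl
  have hB : ∀ s : Fin n, T y j s μ (∑ t ∈ range n, piTv n M R' (bpt n M y j + tstep (fine n M) μ s) ν t
        (cdV (fine n M) R' W (bpt n M y j + tstep (fine n M) μ s + tstep (fine n M) ν t) ν μ))
      = ∑ t : Fin n, pathL n M R' T y j t s ν μ (cdV (fine n M) R' W (bpt n M y j + tstep (fine n M) ν t + tstep (fine n M) μ s) ν μ) := by
    intro s
    have hx : ∀ t : ℕ, bpt n M y j + tstep (fine n M) μ s + tstep (fine n M) ν t = bpt n M y j + tstep (fine n M) ν t + tstep (fine n M) μ s :=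
      fun t => add_right_comm _ _ _
    simp_rw [hx]
    rw [map_sum, ← Fin.sum_univ_eq_sum_range]
    rfl
  simp_rw [hA, hB]
  have hsw : (∑ s : Fin n, ∑ t : Fin n,
        pathL n M R' T y j t s ν μ (cdV (fine n M) R' W (bpt n M y j + tstep (fine n M) ν t + tstep (fine n M) μ s) ν μ))
      = ∑ t : Fin n, ∑ s : Fin n,
        pathL n M R' T y j t s ν μ (cdV (fine n M) R' W (bpt n M y j + tstep (fine n M) ν t + tstep (fine n M) μ s) ν μ) :=
    Finset.sum_comm
  rw [hsw, ← sum_sub_distrib]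
  refine sum_congr rfl fun t _ => ?_
  rw [← sum_sub_distrib]
  refine sum_congr rfl fun s _ => ?_
  simp only [map_sub, sub_apply]
  abel

end Decomposition

/-! ## §3 The pointwise bound -/

section Pointwise

variable {Rc : Tor M → Fin d → (E →L[ℂ] E)} {R' : Tor (fine n M) → Fin d → (E →L[ℂ] E)}
  {T : Tor M → (Fin d → Fin n) → Fin n → Fin d → (E →L[ℂ] E)}

omit [NeZero n] hM in
/-- `‖n^{−(d+1)}‖ = (n^{d+1})⁻¹`. [folklore] -/
theorem norm_invPow : ‖(((n : ℂ) ^ (d + 1))⁻¹ : ℂ)‖ = ((n : ℝ) ^ (d + 1))⁻¹ := by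
  rw [norm_inv, norm_pow, Complex.norm_natCast]

omit [NeZero n] hM in
/-- **POINTWISE BOUND** (contractions `‖R′‖, ‖T‖ ≤ 1`, (M1) `‖Mis‖ ≤ m`, (M2) `‖A − B‖ ≤ w′`, all operator norms; `x_{jst} = n·y + j + t e_ν + s e_μ`):
`‖curl_{Rc}(Q_T W)(y,μ,ν)‖ ≤ (n^{d+1})⁻¹·Σ_j [ Σ_{t,s} ( ‖curl_{R′}W(x_{jst},μ,ν)‖ + w′·(‖W(x_{jst}+e_ν, μ)‖ + ‖W(x_{jst}, μ)‖) )
  + m·Σ_t ‖W(n·y+j+te_ν+ne_μ, ν)‖ + m·Σ_s ‖W(n·y+j+se_μ+ne_ν, μ)‖ ]`. [folklore] -/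
theorem norm_curlV_QvL_le (hR' : ∀ x μ, ‖R' x μ‖ ≤ 1) (hT : ∀ y j t μ, ‖T y j t μ‖ ≤ 1) {m w' : ℝ}
    (hmis : ∀ y j t μ ν, ‖misL n M Rc R' T y j t μ ν‖ ≤ m)
    (hpath : ∀ y j s t μ ν, ‖pathL n M R' T y j s t μ ν - pathL n M R' T y j t s ν μ‖ ≤ w')
    (W : Tor (fine n M) → Fin d → E) (y : Tor M) (μ ν : Fin d) :
    ‖curlV M Rc (QvL n M T W) y μ ν‖
      ≤ ((n : ℝ) ^ (d + 1))⁻¹ * ∑ j : Fin d → Fin n,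
          ( ∑ t : Fin n, ∑ s : Fin n,
              ( ‖curlV (fine n M) R' W (bpt n M y j + tstep (fine n M) ν t + tstep (fine n M) μ s) μ ν‖
                + w' * (‖W (bpt n M y j + tstep (fine n M) ν t + tstep (fine n M) μ s + unitVec (fine n M) ν) μ‖
                    + ‖W (bpt n M y j + tstep (fine n M) ν t + tstep (fine n M) μ s) μ‖) )
            + m * ∑ t : Fin n, ‖W (bpt n M y j + tstep (fine n M) ν t + tstep (fine n M) μ n) ν‖
            + m * ∑ s : Fin n, ‖W (bpt n M y j + tstep (fine n M) μ s + tstep (fine n M) ν n) μ‖ ) := by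
  rw [curlV_QvL_eq n M Rc R' T, norm_smul, norm_invPow]
  refine mul_le_mul_of_nonneg_left ((norm_sum_le _ _).trans (sum_le_sum fun j _ => ?_)) (by positivity)
  refine (norm_sub_le _ _).trans (add_le_add ((norm_add_le _ _).trans (add_le_add ?_ ?_)) ?_)
  · -- the square: main + two-path defect
    refine (norm_sum_le _ _).trans (sum_le_sum fun t _ => (norm_sum_le _ _).trans (sum_le_sum fun s _ => ?_))
    refine (norm_add_le _ _).trans (add_le_add ?_ ?_)
    · calc _ ≤ ‖pathL n M R' T y j s t μ ν‖ * ‖curlV (fine n M) R' W (bpt n M y j + tstep (fine n M) ν t + tstep (fine n M) μ s) μ ν‖ :=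
            ContinuousLinearMap.le_opNorm _ _
        _ ≤ 1 * _ := mul_le_mul_of_nonneg_right (norm_pathL_le_one n M hR' hT _ _ _ _ _ _) (norm_nonneg _)
        _ = _ := one_mul _
    · calc _ ≤ ‖pathL n M R' T y j s t μ ν - pathL n M R' T y j t s ν μ‖
              * ‖cdV (fine n M) R' W (bpt n M y j + tstep (fine n M) ν t + tstep (fine n M) μ s) ν μ‖ := ContinuousLinearMap.le_opNorm _ _
        _ ≤ w' * _ := by
            refine mul_le_mul (hpath _ _ _ _ _ _) ?_ (norm_nonneg _) ((norm_nonneg _).trans (hpath y j s t μ ν))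
            unfold cdV
            refine (norm_sub_le _ _).trans (add_le_add ?_ le_rfl)
            calc _ ≤ ‖R' (bpt n M y j + tstep (fine n M) ν t + tstep (fine n M) μ s) ν‖
                  * ‖W (bpt n M y j + tstep (fine n M) ν t + tstep (fine n M) μ s + unitVec (fine n M) ν) μ‖ := ContinuousLinearMap.le_opNorm _ _
              _ ≤ 1 * _ := mul_le_mul_of_nonneg_right (hR' _ _) (norm_nonneg _)
              _ = _ := one_mul _
  · -- the (μ,ν) mismatch line
    rw [mul_sum]
    refine (norm_sum_le _ _).trans (sum_le_sum fun t _ => ?_)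
    calc _ ≤ ‖misL n M Rc R' T y j t μ ν‖ * ‖W (bpt n M y j + tstep (fine n M) ν t + tstep (fine n M) μ n) ν‖ := ContinuousLinearMap.le_opNorm _ _
      _ ≤ _ := mul_le_mul_of_nonneg_right (hmis _ _ _ _ _) (norm_nonneg _)
  · -- the (ν,μ) mismatch line
    rw [mul_sum]
    refine (norm_sum_le _ _).trans (sum_le_sum fun s _ => ?_)
    calc _ ≤ ‖misL n M Rc R' T y j s ν μ‖ * ‖W (bpt n M y j + tstep (fine n M) μ s + tstep (fine n M) ν n) μ‖ := ContinuousLinearMap.le_opNorm _ _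
      _ ≤ _ := mul_le_mul_of_nonneg_right (hmis _ _ _ _ _) (norm_nonneg _)

end Pointwise

end Summit.QuantumFields.BalabanUV.T4Continuum.VariationalVectorFederbush

end
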